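import Mathlib
import Summits.NavierStokesRegularity.NavierStokesRegularity.Theorems.TaoLadderRungTwoBreakOneShiftWindowExist
import Literature.Analysis.ODE.OneSidedComparison
import HarnessLib

/-!
# The one-shift window system, III: the WINDOW ENERGY, its bond-flux identity, the Grönwall a priori bound,
# and UNCONDITIONAL EXISTENCE of the window run on the whole flight (cell harvest/h2-tao-ladder, seat p2; the
# `Φ`-part of the window certificate `OneShiftWindowCert` of module …OneShiftMapDefs as a THEOREM,
# rung1/RUNG1-P2G9-REPORT.md §37/§40; support for K1(1) = `NoSurvivingDSSOne`, stmt-NavierStokesRegularity-20205)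

MODEL lattice ODEs only (Tao 2016 §4 normal form on Tao's shift set `S`); nothing here is a statement about
the Navier–Stokes equations; no item is closed.

* `wenergy` — the window energy `E(x) = ∑_{i, 0 ≤ j < W} ½ x_{i,j}²`; `norm_le_sqrt_wenergy` (`‖x‖ ≤ √(2E)`);
  `boxEnergy` / `wenergy_encode_le` (the energy of a box state);
* `sum_wfield_mul_eq` — under the cancellation condition (4.3) the energy nonlinearity of the window
  TELESCOPES to the two edge bond fluxes, `∑ wfield · x = B_S(-1) − B_S(W-1)`
  (`TaoCascade.sum_range_sum_quadTermOn_mul_eq_botSumOn`), and `abs_botSumOn_bot_le` / `abs_botSumOn_top_le`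
  bound them by `(∑|α_{··· (0,0,1)}|) · Eb² √(2E)` and `(1+ε₀)^{5W/2} (∑|α|) · 2 E · Et` (slot bounds: the only
  bond-crossing class of `S` is `(0,0,1)`, two inputs on the lower shell);
* `wenergy_le_of_solution` — Grönwall: along every window solution from the box, `E(t) ≤ energyCap` on the
  flight (`energyCap = (boxEnergy + ε_c τ_hi) e^{K_c τ_hi}`, via `Literature.Analysis.ODE.gronwallBound_le_mul_exp`);
* `exists_windowSolution` — HENCE (part II, continuation) the window system has a solution on the WHOLE
  flight `[0, τ_hi]` from every admissible datum: the existence half of the window certificate is a theorem of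
  ODE theory (hypotheses: `W > 0`, `ε₀ ≥ 0`, `α` cancelling, `|tubeC| + tubeR ≤ Eb / Et` at the edge shells).
-/

noncomputable section

-- the sub-problem namespace repeats the summit name by design (D-0017)
set_option linter.dupNamespace false

namespace Summit.NavierStokesRegularity.NavierStokesRegularity.Theorems

namespace DSSOneShift

open Set Metric Filter Topology Literature.Analysis.FluidPDE Literature.Analysis.FluidPDE.TaoCascade
  CertificateGlueOn
open scoped NNReal

variable {m : ℕ}

namespace OneShiftFrame

variable (F : OneShiftFrame m)

/-! ### The window energy -/

/-- The window energy `E(x) = ∑_{i} ∑_{0 ≤ j < W} ½ x_{i,j}²`. [cite: Tao2016AveragedNS, §4 (4.6)/(4.9) (the local energies); cell vocabulary, window-truncated] -/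
def wenergy (x : F.WState) : ℝ := ∑ i, ∑ j, (1 / 2) * x i j ^ 2

/-- `E ≥ 0`. [folklore] -/
theorem wenergy_nonneg (x : F.WState) : 0 ≤ F.wenergy x := by
  unfold wenergy; positivity

/-- One coordinate is controlled by the energy: `x_{i,j}² ≤ 2E`. [folklore] -/
theorem sq_le_two_wenergy (x : F.WState) (i : Fin m) (j : Fin F.W) : x i j ^ 2 ≤ 2 * F.wenergy x := by
  unfold wenergy
  have h1 : (1 / 2) * x i j ^ 2 ≤ ∑ j', (1 / 2) * x i j' ^ 2 :=
    Finset.single_le_sum (f := fun j' => (1 / 2) * x i j' ^ 2) (fun _ _ => by positivity) (Finset.mem_univ j)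
  have h2 : ∑ j', (1 / 2) * x i j' ^ 2 ≤ ∑ i', ∑ j', (1 / 2) * x i' j' ^ 2 :=
    Finset.single_le_sum (f := fun i' => ∑ j', (1 / 2) * x i' j' ^ 2) (fun _ _ => by positivity)
      (Finset.mem_univ i)
  linarith

/-- `|x_{i,j}| ≤ √(2E)`. [folklore] -/
theorem abs_le_sqrt_wenergy (x : F.WState) (i : Fin m) (j : Fin F.W) :
    |x i j| ≤ Real.sqrt (2 * F.wenergy x) :=
  Real.abs_le_sqrt (F.sq_le_two_wenergy x i j)

/-- `‖x‖ ≤ √(2E)` (sup norm). [folklore] -/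
theorem norm_le_sqrt_wenergy (x : F.WState) : ‖x‖ ≤ Real.sqrt (2 * F.wenergy x) :=
  (pi_norm_le_iff_of_nonneg (Real.sqrt_nonneg _)).2 fun i =>
    (pi_norm_le_iff_of_nonneg (Real.sqrt_nonneg _)).2 fun j => by
      rw [Real.norm_eq_abs]; exact F.abs_le_sqrt_wenergy x i j

/-- The largest energy of a box state, `∑ ½ (|ŷ_{i,j}| + a_{i,j})²`. [cite: Tao2016AveragedNS, §4 (4.6); cell vocabulary, harvest/h2-tao-ladder rung1/STAGE2-LEMMA.md §2 (the box X)] -/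
def boxEnergy : ℝ := ∑ i, ∑ j : Fin F.W, (1 / 2) * (|F.yc i ((j : ℕ) : ℤ)| + F.a i ((j : ℕ) : ℤ)) ^ 2

/-- `boxEnergy ≥ 0`. [folklore] -/
theorem boxEnergy_nonneg : 0 ≤ F.boxEnergy := by
  unfold boxEnergy; positivity

/-- A box state has energy at most `boxEnergy`. [folklore] -/
theorem wenergy_encode_le {y : Fin m → ℤ → ℝ} (hy : ∀ i k, F.InWindow k → |y i k - F.yc i k| ≤ F.a i k) :
    F.wenergy (F.encode y) ≤ F.boxEnergy := by
  unfold wenergy boxEnergy encode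
  refine Finset.sum_le_sum fun i _ => Finset.sum_le_sum fun j _ => ?_
  have h := hy i _ (F.inWindow_natCast j)
  have h1 : |y i ((j : ℕ) : ℤ)| ≤ |F.yc i ((j : ℕ) : ℤ)| + F.a i ((j : ℕ) : ℤ) := by
    have := abs_add_le (y i ((j : ℕ) : ℤ) - F.yc i ((j : ℕ) : ℤ)) (F.yc i ((j : ℕ) : ℤ))
    simp only [sub_add_cancel] at this
    linarith
  have h2 : y i ((j : ℕ) : ℤ) ^ 2 ≤ (|F.yc i ((j : ℕ) : ℤ)| + F.a i ((j : ℕ) : ℤ)) ^ 2 := by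
    rw [← sq_abs (y i _)]
    exact pow_le_pow_left₀ (abs_nonneg _) h1 2
  linarith

/-! ### The energy identity: only the two edge bonds move the window energy -/

/-- The size of the bond-crossing class `(0,0,1)` of the table, `∑_{i₁,i₂,i₃} |α_{i₁ i₂ i₃ (0,0,1)}|`.
[cite: Tao2016AveragedNS, §4 proof of Lemma 4.1 (v) (the boundary terms)] -/
def botCoeff (α : Fin m → Fin m → Fin m → ℤ × ℤ × ℤ → ℝ) : ℝ :=
  ∑ i₁, ∑ i₂, ∑ i₃, |α i₁ i₂ i₃ ((0 : ℤ), (0 : ℤ), (1 : ℤ))|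

/-- `botCoeff ≥ 0`. [folklore] -/
theorem botCoeff_nonneg (α : Fin m → Fin m → Fin m → ℤ × ℤ × ℤ → ℝ) : 0 ≤ botCoeff α := by
  unfold botCoeff; positivity

/-- The derivative of the window energy along a window solution. [cite: Tao2016AveragedNS, §4 (4.9) (equality case along exact solutions)] -/
theorem hasDerivWithinAt_wenergy {ε₀ : ℝ} {α : Fin m → Fin m → Fin m → ℤ × ℤ × ℤ → ℝ}
    {T : Fin m → ℤ → ℝ → ℝ} {β : ℝ → F.WState} {s t : ℝ}
    (hβ : HasDerivWithinAt β (F.wfield ε₀ α T t (β t)) (Icc 0 s) t) :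
    HasDerivWithinAt (fun u => F.wenergy (β u))
      (∑ i, ∑ j, F.wfield ε₀ α T t (β t) i j * β t i j) (Icc 0 s) t := by
  have hc : ∀ i j, HasDerivWithinAt (fun u => β u i j) (F.wfield ε₀ α T t (β t) i j) (Icc 0 s) t :=
    fun i j => (hasDerivWithinAt_pi.1 ((hasDerivWithinAt_pi.1 hβ) i)) j
  have h : ∀ i j, HasDerivWithinAt (fun u => (1 / 2) * β u i j ^ 2)
      (F.wfield ε₀ α T t (β t) i j * β t i j) (Icc 0 s) t := by
    intro i j
    have h2 := ((hc i j).pow 2).const_mul (1 / 2 : ℝ)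
    exact h2.congr_deriv (by rw [show (2 : ℕ) - 1 = 1 from rfl, pow_one, Nat.cast_ofNat]; ring)
  have hs : ∀ i, HasDerivWithinAt (fun u => ∑ j, (1 / 2) * β u i j ^ 2)
      (∑ j, F.wfield ε₀ α T t (β t) i j * β t i j) (Icc 0 s) t :=
    fun i => HasDerivWithinAt.fun_sum fun j _ => h i j
  simpa [wenergy] using (HasDerivWithinAt.fun_sum fun i _ => hs i)

/-- **The window energy nonlinearity telescopes to the two edge bond fluxes** under (4.3):
`∑_{i,j} wfield(x)_{i,j} x_{i,j} = B_S(-1) − B_S(W-1)` (evaluated on the assembled family).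
[cite: Tao2016AveragedNS, §4 (4.3) and proof of Lemma 4.1 (v) ("all the terms here can be grouped into terms that sum to zero, except for …")] -/
theorem sum_wfield_mul_eq {ε₀ : ℝ} {α : Fin m → Fin m → Fin m → ℤ × ℤ × ℤ → ℝ} (hα : IsCancellingCoeff α)
    (T : Fin m → ℤ → ℝ → ℝ) (t : ℝ) (x : F.WState) :
    ∑ i, ∑ j, F.wfield ε₀ α T t x i j * x i j =
      botSumOn shiftSet ε₀ α (F.assemble x T) (-1) t -
        botSumOn shiftSet ε₀ α (F.assemble x T) ((F.W : ℤ) - 1) t := by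
  rw [Finset.sum_comm]
  have hx : ∀ i (j : Fin F.W), x i j = F.assemble x T i ((j : ℕ) : ℤ) t := by
    intro i j; simp only [assemble, dif_pos (F.inWindow_natCast j), F.widx_natCast]
  set g : ℕ → ℝ := fun k => ∑ i, quadTermOn shiftSet ε₀ α (F.assemble x T) i ((0 : ℤ) + k) t *
    F.assemble x T i ((0 : ℤ) + k) t with hg
  have h1 : ∑ j : Fin F.W, ∑ i, F.wfield ε₀ α T t x i j * x i j = ∑ j : Fin F.W, g (j : ℕ) := by
    refine Finset.sum_congr rfl fun j _ => Finset.sum_congr rfl fun i _ => ?_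
    rw [zero_add, quadTermOn_shiftSet, ← hx]
    rfl
  rw [h1, Fin.sum_univ_eq_sum_range g, hg,
    sum_range_sum_quadTermOn_mul_eq_botSumOn isSlotClosed_shiftSet
      (fun μ hμ => (isNearestNeighbourSet_shiftSet μ hμ).2.2) ε₀ hα]
  norm_num

/-- **Bound of the bottom bond flux** (`ε₀ ≥ 0`, `W > 0`): with the wake input bounded by `Eb' ≥ 0`,
`|B_S(-1)| ≤ (∑|α_{···(0,0,1)}|) · Eb'² · √(2E(x))` (class `(0,0,1)`: both inputs on the wake shell, output on
shell `0`). [cite: Tao2016AveragedNS, §4 proof of Lemma 4.1 (v) (the boundary terms)] -/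
theorem abs_botSumOn_bot_le {ε₀ : ℝ} (hε : 0 ≤ ε₀) (hW : 0 < F.W)
    (α : Fin m → Fin m → Fin m → ℤ × ℤ × ℤ → ℝ) {T : Fin m → ℤ → ℝ → ℝ} {t : ℝ} {x : F.WState} {Eb' : ℝ}
    (hEb' : 0 ≤ Eb') (hTb : ∀ i, |T i (-1) t| ≤ Eb') :
    |botSumOn shiftSet ε₀ α (F.assemble x T) (-1) t| ≤
      botCoeff α * (Eb' ^ 2 * Real.sqrt (2 * F.wenergy x)) := by
  have hε' : 0 < 1 + ε₀ := by linarith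
  have h0 : F.InWindow 0 := ⟨le_rfl, by exact_mod_cast hW⟩
  have hm1 : ¬ F.InWindow (-1) := fun h => by have := h.1; omega
  set B : ℤ → ℝ := fun k => if k = 0 then Real.sqrt (2 * F.wenergy x) else Eb' with hB
  have hB0 : ∀ k, 0 ≤ B k := fun k => by
    simp only [hB]; split_ifs
    · exact Real.sqrt_nonneg _
    · exact hEb'
  have hBz : B 0 = Real.sqrt (2 * F.wenergy x) := by simp [hB]
  have hBm : B (-1) = Eb' := by simp [hB]
  have hXz : ∀ i, |F.assemble x T i 0 t| ≤ B 0 := fun i => by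
    rw [hBz]; simp only [assemble, dif_pos h0]; exact F.abs_le_sqrt_wenergy x i _
  have hXm : ∀ i, |F.assemble x T i (-1) t| ≤ B (-1) := fun i => by
    rw [hBm]; simp only [assemble, dif_neg hm1]; exact hTb i
  have key := abs_fullSumOn_le_of_slot_bounds (𝕋 := botShifts shiftSet) ε₀ hε' α (F.assemble x T) (-1) t
    hB0 (fun μ hμ i => by
      rw [botShifts_shiftSet, Finset.mem_singleton] at hμ
      subst hμ
      simp only [add_zero, neg_add_cancel]
      exact ⟨hXm i, hXm i, hXz i⟩)
  rw [botSumOn]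
  refine key.trans ?_
  rw [botShifts_shiftSet]
  simp only [Finset.sum_singleton, add_zero, neg_add_cancel, hBz, hBm]
  have hgain : (1 + ε₀) ^ ((5 : ℝ) * ((-1 : ℤ) : ℝ) / 2) ≤ 1 :=
    Real.rpow_le_one_of_one_le_of_nonpos (by linarith) (by norm_num)
  have hsum : ∑ i₁, ∑ i₂, ∑ i₃, |α i₁ i₂ i₃ (0, 0, 1)| * (Eb' * Eb' * Real.sqrt (2 * F.wenergy x)) =
      botCoeff α * (Eb' ^ 2 * Real.sqrt (2 * F.wenergy x)) := by
    simp only [botCoeff, Finset.sum_mul]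
    refine Finset.sum_congr rfl fun _ _ => Finset.sum_congr rfl fun _ _ => Finset.sum_congr rfl fun _ _ => ?_
    ring
  rw [hsum]
  have hpos : 0 ≤ botCoeff α * (Eb' ^ 2 * Real.sqrt (2 * F.wenergy x)) := by
    have := botCoeff_nonneg α; positivity
  have hg0 : 0 ≤ (1 + ε₀) ^ ((5 : ℝ) * ((-1 : ℤ) : ℝ) / 2) := Real.rpow_nonneg hε'.le _
  nlinarith

/-- **Bound of the top bond flux** (`ε₀ ≥ 0`, `W > 0`): with the top input bounded by `Et' ≥ 0`,
`|B_S(W-1)| ≤ (1+ε₀)^{5W/2} (∑|α_{···(0,0,1)}|) · 2E(x) · Et'` (both inputs on the window shell `W-1`, output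
on the top shell `W`). [cite: Tao2016AveragedNS, §4 proof of Lemma 4.1 (v) (the boundary terms)] -/
theorem abs_botSumOn_top_le {ε₀ : ℝ} (hε : 0 ≤ ε₀) (hW : 0 < F.W)
    (α : Fin m → Fin m → Fin m → ℤ × ℤ × ℤ → ℝ) {T : Fin m → ℤ → ℝ → ℝ} {t : ℝ} {x : F.WState} {Et' : ℝ}
    (hEt' : 0 ≤ Et') (hTt : ∀ i, |T i F.W t| ≤ Et') :
    |botSumOn shiftSet ε₀ α (F.assemble x T) ((F.W : ℤ) - 1) t| ≤
      F.gainW ε₀ * botCoeff α * (2 * F.wenergy x * Et') := by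
  have hε' : 0 < 1 + ε₀ := by linarith
  have hWm : F.InWindow ((F.W : ℤ) - 1) := ⟨by omega, by omega⟩
  have hWn : ¬ F.InWindow (F.W : ℤ) := fun h => by have := h.2; omega
  have hne : ((F.W : ℤ) - 1) ≠ F.W := by omega
  set B : ℤ → ℝ := fun k => if k = F.W then Et' else Real.sqrt (2 * F.wenergy x) with hB
  have hB0 : ∀ k, 0 ≤ B k := fun k => by
    simp only [hB]; split_ifs
    · exact hEt'
    · exact Real.sqrt_nonneg _
  have hBW : B F.W = Et' := by simp [hB]
  have hBWm : B ((F.W : ℤ) - 1) = Real.sqrt (2 * F.wenergy x) := by simp [hB]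
  have hXW : ∀ i, |F.assemble x T i F.W t| ≤ B F.W := fun i => by
    rw [hBW]; simp only [assemble, dif_neg hWn]; exact hTt i
  have hXWm : ∀ i, |F.assemble x T i ((F.W : ℤ) - 1) t| ≤ B ((F.W : ℤ) - 1) := fun i => by
    rw [hBWm]; simp only [assemble, dif_pos hWm]; exact F.abs_le_sqrt_wenergy x i _
  have key := abs_fullSumOn_le_of_slot_bounds (𝕋 := botShifts shiftSet) ε₀ hε' α (F.assemble x T)
    ((F.W : ℤ) - 1) t hB0 (fun μ hμ i => by
      rw [botShifts_shiftSet, Finset.mem_singleton] at hμ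
      subst hμ
      simp only [add_zero, sub_add_cancel]
      exact ⟨hXWm i, hXWm i, hXW i⟩)
  rw [botSumOn]
  refine key.trans ?_
  rw [botShifts_shiftSet]
  simp only [Finset.sum_singleton, add_zero, sub_add_cancel, hBW, hBWm]
  have hsq : Real.sqrt (2 * F.wenergy x) * Real.sqrt (2 * F.wenergy x) = 2 * F.wenergy x :=
    Real.mul_self_sqrt (by have := F.wenergy_nonneg x; positivity)
  have hsum : ∑ i₁, ∑ i₂, ∑ i₃, |α i₁ i₂ i₃ (0, 0, 1)| *
      (Real.sqrt (2 * F.wenergy x) * Real.sqrt (2 * F.wenergy x) * Et') =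
      botCoeff α * (2 * F.wenergy x * Et') := by
    rw [hsq]; simp only [botCoeff, Finset.sum_mul]
  rw [hsum]
  have hgain : (1 + ε₀) ^ ((5 : ℝ) * (((F.W : ℤ) - 1 : ℤ) : ℝ) / 2) ≤ F.gainW ε₀ := by
    unfold gainW
    refine Real.rpow_le_rpow_of_exponent_le (by linarith) ?_
    push_cast; linarith
  have hpos : 0 ≤ botCoeff α * (2 * F.wenergy x * Et') := by
    have := botCoeff_nonneg α; have := F.wenergy_nonneg x; positivity
  calc (1 + ε₀) ^ ((5 : ℝ) * (((F.W : ℤ) - 1 : ℤ) : ℝ) / 2) * (botCoeff α * (2 * F.wenergy x * Et'))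
      ≤ F.gainW ε₀ * (botCoeff α * (2 * F.wenergy x * Et')) := mul_le_mul_of_nonneg_right hgain hpos
    _ = F.gainW ε₀ * botCoeff α * (2 * F.wenergy x * Et') := by ring

/-! ### Grönwall -/

/-- The Grönwall rate constant `K_c = (∑|α_{···(0,0,1)}|)(Eb² + 2 (1+ε₀)^{5W/2} |Et|)`. [cite: Tao2016AveragedNS, §4 proof of Lemma 4.1 (v); Teschl2012, Lemma 2.7 (Grönwall)] -/
def rateConst (ε₀ : ℝ) (α : Fin m → Fin m → Fin m → ℤ × ℤ × ℤ → ℝ) : ℝ :=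
  botCoeff α * (F.Eb ^ 2 + 2 * F.gainW ε₀ * |F.Et|)

/-- The Grönwall inhomogeneity `ε_c = (∑|α_{···(0,0,1)}|) Eb² / 2`. [cite: Tao2016AveragedNS, §4 proof of Lemma 4.1 (v); Teschl2012, Lemma 2.7] -/
def driftConst (α : Fin m → Fin m → Fin m → ℤ × ℤ × ℤ → ℝ) : ℝ :=
  botCoeff α * F.Eb ^ 2 / 2

/-- **The energy cap on the flight**: `(boxEnergy + ε_c τ_hi) · e^{K_c τ_hi}`. [cite: Teschl2012, Lemma 2.7 (Grönwall); cell vocabulary] -/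
def energyCap (ε₀ : ℝ) (α : Fin m → Fin m → Fin m → ℤ × ℤ × ℤ → ℝ) : ℝ :=
  (F.boxEnergy + F.driftConst α * F.τhi) * Real.exp (F.rateConst ε₀ α * F.τhi)

/-- `√(2E) ≤ ½ + E`. [folklore] -/
theorem sqrt_two_mul_le {E : ℝ} (hE : 0 ≤ E) : Real.sqrt (2 * E) ≤ 1 / 2 + E := by
  nlinarith [Real.sq_sqrt (by positivity : (0 : ℝ) ≤ 2 * E), Real.sqrt_nonneg (2 * E),
    sq_nonneg (Real.sqrt (2 * E) - 1)]

/-- **The differential inequality of the window energy** along a window solution with admissible tails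
(`ε₀ ≥ 0`, `W > 0`, `α` cancelling, edge bounds): `|E'| ≤ K_c E + ε_c`.
[cite: Tao2016AveragedNS, §4 (4.3) and proof of Lemma 4.1 (v); Teschl2012, Lemma 2.7] -/
theorem abs_wenergy_deriv_le {ε₀ : ℝ} (hε : 0 ≤ ε₀) (hW : 0 < F.W)
    {α : Fin m → Fin m → Fin m → ℤ × ℤ × ℤ → ℝ} (hα : IsCancellingCoeff α)
    {T : Fin m → ℤ → ℝ → ℝ} {t : ℝ} (hTb : ∀ i, |T i (-1) t| ≤ F.Eb) (hTt : ∀ i, |T i F.W t| ≤ F.Et)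
    (x : F.WState) :
    |∑ i, ∑ j, F.wfield ε₀ α T t x i j * x i j| ≤ F.rateConst ε₀ α * F.wenergy x + F.driftConst α := by
  rw [F.sum_wfield_mul_eq hα T t x]
  have hEb0 : 0 ≤ |F.Eb| := abs_nonneg _
  have hEt0 : 0 ≤ |F.Et| := abs_nonneg _
  have hb := F.abs_botSumOn_bot_le hε hW α (x := x) hEb0 (fun i => (hTb i).trans (le_abs_self _))
  have ht := F.abs_botSumOn_top_le hε hW α (x := x) hEt0 (fun i => (hTt i).trans (le_abs_self _))
  have hE := F.wenergy_nonneg x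
  have hs := sqrt_two_mul_le hE
  have hc := botCoeff_nonneg α
  have hg := (F.gainW_pos hε).le
  have h1 : |botSumOn shiftSet ε₀ α (F.assemble x T) (-1) t -
      botSumOn shiftSet ε₀ α (F.assemble x T) ((F.W : ℤ) - 1) t| ≤
      botCoeff α * (|F.Eb| ^ 2 * Real.sqrt (2 * F.wenergy x)) +
        F.gainW ε₀ * botCoeff α * (2 * F.wenergy x * |F.Et|) :=
    (abs_sub _ _).trans (add_le_add hb ht)
  refine h1.trans ?_
  rw [sq_abs]
  unfold rateConst driftConst
  have h2 : botCoeff α * (F.Eb ^ 2 * Real.sqrt (2 * F.wenergy x)) ≤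
      botCoeff α * (F.Eb ^ 2 * (1 / 2 + F.wenergy x)) :=
    mul_le_mul_of_nonneg_left (mul_le_mul_of_nonneg_left hs (sq_nonneg _)) hc
  nlinarith

/-- **GRÖNWALL A PRIORI BOUND**: along every window solution from a box state with admissible tails, the
window energy stays below `energyCap` on the flight. [cite: Teschl2012, Lemma 2.7 (Grönwall); Tao2016AveragedNS, §4 proof of Lemma 4.1 (v)] -/
theorem wenergy_le_of_solution {ε₀ : ℝ} (hε : 0 ≤ ε₀) (hW : 0 < F.W)
    {α : Fin m → Fin m → Fin m → ℤ × ℤ × ℤ → ℝ} (hα : IsCancellingCoeff α)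
    {y : Fin m → ℤ → ℝ} {T : Fin m → ℤ → ℝ → ℝ} (hyT : F.AdmData y T)
    (hEb : ∀ i, |F.tubeC i (-1)| + F.tubeR (-1) ≤ F.Eb) (hEt : ∀ i, |F.tubeC i F.W| + F.tubeR F.W ≤ F.Et)
    {s : ℝ} (hs : s ∈ Icc 0 F.τhi) {β : ℝ → F.WState}
    (hβ : ∀ t ∈ Icc 0 s, HasDerivWithinAt β (F.wfield ε₀ α T t (β t)) (Icc 0 s) t)
    (hβ0 : β 0 = F.encode y) : ∀ t ∈ Icc 0 s, F.wenergy (β t) ≤ F.energyCap ε₀ α := by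
  have hm1 : ¬ F.InWindow (-1) := fun h => by have := h.1; omega
  have hWn : ¬ F.InWindow (F.W : ℤ) := fun h => by have := h.2; omega
  -- edge inputs along the flight
  have hedge : ∀ u ∈ Icc 0 F.τhi, (∀ i, |T i (-1) u| ≤ F.Eb) ∧ (∀ i, |T i F.W u| ≤ F.Et) := by
    intro u hu
    refine ⟨fun i => ?_, fun i => ?_⟩
    · have h1 := hyT.2.2 i (-1) hm1 u hu
      have h3 : |T i (-1) u| ≤ |T i (-1) u - F.tubeC i (-1)| + |F.tubeC i (-1)| := by
        have := abs_add_le (T i (-1) u - F.tubeC i (-1)) (F.tubeC i (-1)); simpa using this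
      linarith [hEb i]
    · have h1 := hyT.2.2 i F.W hWn u hu
      have h3 : |T i F.W u| ≤ |T i F.W u - F.tubeC i F.W| + |F.tubeC i F.W| := by
        have := abs_add_le (T i F.W u - F.tubeC i F.W) (F.tubeC i F.W); simpa using this
      linarith [hEt i]
  have hK0 : 0 ≤ F.rateConst ε₀ α := by
    unfold rateConst; have := botCoeff_nonneg α; have := (F.gainW_pos hε).le; positivity
  have hε0 : 0 ≤ F.driftConst α := by
    unfold driftConst; have := botCoeff_nonneg α; positivity
  have hG := norm_le_gronwallBound_of_norm_deriv_right_le (E := ℝ) (f := fun u => F.wenergy (β u))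
    (f' := fun u => ∑ i, ∑ j, F.wfield ε₀ α T u (β u) i j * β u i j) (δ := F.boxEnergy)
    (K := F.rateConst ε₀ α) (ε := F.driftConst α) (a := 0) (b := s)
    (fun u hu => (F.hasDerivWithinAt_wenergy (hβ u hu)).continuousWithinAt)
    (fun u hu => (F.hasDerivWithinAt_wenergy (hβ u ⟨hu.1, hu.2.le⟩)).mono_of_mem_nhdsWithin
      (mem_of_superset (Icc_mem_nhdsGE hu.2) (Icc_subset_Icc_left hu.1)))
    (by
      rw [Real.norm_eq_abs, abs_of_nonneg (F.wenergy_nonneg _), hβ0]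
      exact F.wenergy_encode_le hyT.1)
    (fun u hu => by
      rw [Real.norm_eq_abs, Real.norm_eq_abs, abs_of_nonneg (F.wenergy_nonneg _)]
      have hu' : u ∈ Icc 0 F.τhi := ⟨hu.1, hu.2.le.trans hs.2⟩
      exact F.abs_wenergy_deriv_le hε hW hα (hedge u hu').1 (hedge u hu').2 (β u))
  intro t ht
  have h1 := hG t ht
  rw [Real.norm_eq_abs, abs_of_nonneg (F.wenergy_nonneg _), sub_zero] at h1
  refine h1.trans ((Literature.Analysis.ODE.gronwallBound_le_mul_exp hε0 hK0).trans ?_)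
  unfold energyCap
  have ht' : t ≤ F.τhi := ht.2.trans hs.2
  have hB := F.boxEnergy_nonneg
  have he : Real.exp (F.rateConst ε₀ α * t) ≤ Real.exp (F.rateConst ε₀ α * F.τhi) :=
    Real.exp_le_exp.2 (mul_le_mul_of_nonneg_left ht' hK0)
  have he0 := Real.exp_pos (F.rateConst ε₀ α * t)
  calc (F.boxEnergy + F.driftConst α * t) * Real.exp (F.rateConst ε₀ α * t)
      ≤ (F.boxEnergy + F.driftConst α * F.τhi) * Real.exp (F.rateConst ε₀ α * t) := by
        gcongr
    _ ≤ (F.boxEnergy + F.driftConst α * F.τhi) * Real.exp (F.rateConst ε₀ α * F.τhi) := by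
        have : 0 ≤ F.boxEnergy + F.driftConst α * F.τhi := by
          have := F.τhi_pos; positivity
        exact mul_le_mul_of_nonneg_left he this

/-! ### Unconditional existence of the window run -/

/-- **THE WINDOW RUN EXISTS ON THE WHOLE FLIGHT** (`W > 0`, `ε₀ ≥ 0`, `α` cancelling,
`|tubeC| + tubeR ≤ Eb / Et` at the edge shells): from every admissible datum `(y, T)` the window system has a
solution on `[0, τ_hi]` starting at `encode y` — energy a priori bound + continuation.
[cite: Teschl2012, Cor. 2.16 and Lemma 2.7; Tao2016AveragedNS, §4 Lemma 4.1 (4.8), (4.3)] -/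
theorem exists_windowSolution {ε₀ : ℝ} (hε : 0 ≤ ε₀) (hW : 0 < F.W)
    {α : Fin m → Fin m → Fin m → ℤ × ℤ × ℤ → ℝ} (hα : IsCancellingCoeff α)
    (hEb : ∀ i, |F.tubeC i (-1)| + F.tubeR (-1) ≤ F.Eb) (hEt : ∀ i, |F.tubeC i F.W| + F.tubeR F.W ≤ F.Et)
    {y : Fin m → ℤ → ℝ} {T : Fin m → ℤ → ℝ → ℝ} (hyT : F.AdmData y T) :
    ∃ β : ℝ → F.WState, β 0 = F.encode y ∧
      ∀ t ∈ Icc 0 F.τhi, HasDerivWithinAt β (F.wfield ε₀ α T t (β t)) (Icc 0 F.τhi) t :=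
  F.exists_windowSolution_of_apriori hε α hyT (R := Real.sqrt (2 * F.energyCap ε₀ α))
    (Real.sqrt_nonneg _) fun s hs β hβ hβ0 t ht =>
      (F.norm_le_sqrt_wenergy (β t)).trans (Real.sqrt_le_sqrt (by
        linarith [F.wenergy_le_of_solution hε hW hα hyT hEb hEt hs hβ hβ0 t ht]))

end OneShiftFrame

end DSSOneShift

end Summit.NavierStokesRegularity.NavierStokesRegularity.Theorems
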